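import Mathlib.AlgebraicGeometry.Morphisms.ClosedImmersion
import Mathlib.AlgebraicGeometry.IdealSheaf.Functorial
import Literature.AlgebraicGeometry.Motives.BaseChange
import Literature.AlgebraicGeometry.Motives.BaseChangeHomDescent
import Literature.AlgebraicGeometry.Motives.ComplexAutGaloisDescentIdealSheaf
import HarnessLib

/-!
# Morphisms from reduced schemes INTO closed subschemes: set-theoretic factorisation suffices; towers of closed subschemes

Topic `AlgebraicGeometry/Motives`, namespace `Literature.AlgebraicGeometry.Motives`.  THEOREMS ONLY (no definition, no
named fact, no instance, no `sorry`).

* `ker_le_ker_of_range_subset` — if `f : X ⟶ Z` is a closed immersion, `Y` is REDUCED and `g : Y ⟶ Z` lands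
  set-theoretically in the image of `f`, then `ker f ≤ ker g` (the kernel of a morphism from a reduced scheme is the
  vanishing ideal sheaf of the closure of its image); hence (`existsUnique_comp_eq_of_range_subset`) `g` factors UNIQUELY
  through `f` (Mathlib's universal property `IsClosedImmersion.lift` + closed immersions are monomorphisms).  This is
  [GortzWedhorn2020] Prop. 4.32 / [StacksProject] Tag 0356 («a morphism from a reduced scheme into `X` whose image is
  contained in the closed subset `T` factors uniquely through the reduced induced closed subscheme structure on `T`»,
  here for any closed subscheme containing the image).  `Over` form `existsUnique_overHom_comp_eq_of_range_subset`.
* `range_subset_of_baseChangeHom` — the set-theoretic hypothesis may be checked after a base change to a larger field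
  (`Motives.baseChangeHom σ`; the projection `Y ⊗_σ L → Y` is surjective).
* `exists_functor_of_forall_range_subset` — **towers of closed subschemes**: given a diagram `N : C ⥤ Over S` of
  `S`-schemes and, at each `c`, a closed subscheme `j c : Z c ↪ N c` with `Z c` reduced, such that every transition
  `N.map f` carries the image of `j c` into the image of `j c'`, the `Z c` assemble into a functor `M : C ⥤ Over S` with a
  natural transformation `ι : M ⟶ N`, `ι.app c = j c` (the restricted transitions exist and are unique by the first item;
  functoriality is uniqueness).  This is the bookkeeping half of «closure descent for a TOWER» ([Deligne1971TravauxShimura]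
  Variante 5.9 after Cor. 5.7: the descended closed subschemes of the levels of a canonical model form a projective system):
  once every level of a Galois-stable reduced closed sub-tower of `(N c)_ℂ` has been descended to a closed `K`-subscheme
  `Z c ↪ N c` (the tree's ★ `GaloisDescent.exists_iso_bcFunctor_map_eq_of_isReduced_of_image_subset_complex`), the
  transitions descend by `range_subset_of_baseChangeHom` + this theorem — no further Galois argument.
* `exists_subtower_of_stable` — **the assembled statement**: for `K ⊆ ℂ` countable, a diagram `N : C ⥤ SchemeOver K`, a
  diagram `Y : C ⥤ SchemeOver ℂ` of reduced `ℂ`-schemes and natural closed immersions `κ c : Y c ⟶ (N c) ⊗_K ℂ` with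
  `Aut(ℂ/K)`-stable images, there are `M : C ⥤ SchemeOver K`, closed immersions `ι : M ⟶ N` and `M ⊗_K ℂ ≅ Y` over `κ`
  ([Deligne1971TravauxShimura] Cor. 5.7 + Variante 5.9; [Margulis1991] I (0.11)).

Use (cell `hodgecm-mathlib`, road (ii) «embedded-curve descent» R2-4/R2-5): `N :=` the canonical model of the unitary
Shimura SURFACE along the chosen levels, `Z c :=` the descended special curves; the output `M` is the functor field of a
`RecordSystemGS`.

## References
* [GortzWedhorn2020] U. Görtz, T. Wedhorn, *Algebraic Geometry I* (2nd ed. 2020), Prop. 4.32 (reduced subschemes), §(4.9).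
* [StacksProject] The Stacks Project, Tag 0356 (factorisation through the reduced induced structure), Tag 01QN.
* [Deligne1971TravauxShimura] P. Deligne, *Travaux de Shimura* (1971), Cor. 5.7 and Variante 5.9 p. 156–157.
-/

noncomputable section

open CategoryTheory CategoryTheory.Limits AlgebraicGeometry TopologicalSpace

set_option autoImplicit false

universe w v u

namespace Literature.AlgebraicGeometry.Motives

/-! ## §1 Kernel comparison and unique factorisation through a closed immersion (reduced source) -/

section Lift

variable {X Y Z : Scheme.{u}}

/-- **`ker f ≤ ker g` when the reduced `Y` maps into the image of the closed immersion `f`.**  For `Y` reduced,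
`ker g` is the vanishing ideal sheaf of the closure of `range g` (Mathlib `map_vanishingIdeal` applied to the nilradical
`= ⊥`), while `ker f` vanishes on `range f ⊇ range g` (`Hom.range_subset_ker_support`); the Galois connection
`support ⊣ vanishingIdeal` concludes. [cite: GortzWedhorn2020, Prop. 4.32] [cite: StacksProject, Tag 0356] -/
theorem ker_le_ker_of_range_subset (f : X ⟶ Z) (g : Y ⟶ Z) [IsReduced Y]
    (h : Set.range ⇑g ⊆ Set.range ⇑f) : f.ker ≤ g.ker := by
  rw [← Scheme.IdealSheafData.map_bot g, ← Scheme.nilradical_eq_bot (X := Y),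
    ← Scheme.IdealSheafData.vanishingIdeal_top, Scheme.IdealSheafData.map_vanishingIdeal,
    ← Scheme.IdealSheafData.le_support_iff_le_vanishingIdeal, Closeds.closure_le]
  rintro _ ⟨y, -, rfl⟩
  exact (h.trans f.range_subset_ker_support) ⟨y, rfl⟩

/-- **A morphism from a reduced scheme factors uniquely through any closed immersion containing its image**
([GortzWedhorn2020] Prop. 4.32; [StacksProject] Tag 0356): for a closed immersion `f : X ⟶ Z`, a reduced `Y` and
`g : Y ⟶ Z` with `range g ⊆ range f` there is a unique `m : Y ⟶ X` with `m ≫ f = g` (existence: Mathlib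
`IsClosedImmersion.lift` with `ker_le_ker_of_range_subset`; uniqueness: closed immersions are monomorphisms).
[cite: GortzWedhorn2020, Prop. 4.32] [cite: StacksProject, Tag 0356] -/
theorem existsUnique_comp_eq_of_range_subset (f : X ⟶ Z) [IsClosedImmersion f] (g : Y ⟶ Z) [IsReduced Y]
    (h : Set.range ⇑g ⊆ Set.range ⇑f) : ∃! m : Y ⟶ X, m ≫ f = g := by
  refine ⟨IsClosedImmersion.lift f g (ker_le_ker_of_range_subset f g h),
    IsClosedImmersion.lift_fac f g _, fun m hm => ?_⟩
  rw [← cancel_mono f, hm, IsClosedImmersion.lift_fac]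

/-- **`Over` form** (schemes over a base `S`; the lift is automatically an `S`-morphism): for `S`-schemes `X Y Z`, a
closed immersion `f : X ⟶ Z` over `S`, `Y` reduced and `g : Y ⟶ Z` over `S` with `range g ⊆ range f`, there is a unique
`S`-morphism `m : Y ⟶ X` with `m ≫ f = g`. [cite: GortzWedhorn2020, Prop. 4.32] [cite: StacksProject, Tag 0356] -/
theorem existsUnique_overHom_comp_eq_of_range_subset {S : Scheme.{u}} {X Y Z : Over S} (f : X ⟶ Z)
    [IsClosedImmersion f.left] (g : Y ⟶ Z) [IsReduced Y.left]
    (h : Set.range ⇑g.left ⊆ Set.range ⇑f.left) : ∃! m : Y ⟶ X, m ≫ f = g := by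
  obtain ⟨m₀, hm₀, huniq⟩ := existsUnique_comp_eq_of_range_subset f.left g.left h
  have hw : m₀ ≫ X.hom = Y.hom := by
    rw [← Over.w f, ← Category.assoc, hm₀, Over.w g]
  refine ⟨Over.homMk m₀ hw, ?_, fun m hm => ?_⟩
  · ext
    simp only [Over.comp_left, Over.homMk_left, hm₀]
  · ext
    simp only [Over.homMk_left]
    refine huniq _ ?_
    change m.left ≫ f.left = g.left
    rw [← Over.comp_left, hm]

end Lift

/-! ## §2 Checking the set-theoretic hypothesis after a field extension -/

section BaseChange

variable {k L : Type u} [Field k] [Field L] (σ : k →+* L)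

/-- `Spec L → Spec k` is surjective for a homomorphism of fields (both spectra are points). [folklore] -/
private theorem surjective_specMap_ofHom' : Surjective (Spec.map (CommRingCat.ofHom σ)) := by
  haveI : Subsingleton ↥(Spec (CommRingCat.of k)) :=
    inferInstanceAs (Subsingleton (PrimeSpectrum k))
  exact ⟨fun x ↦ ⟨(default : ↥(Spec (CommRingCat.of L))), Subsingleton.elim _ _⟩⟩

/-- **The image inclusion `range g ⊆ range f` may be checked after base change to a larger field**: for `k`-morphisms
`f : X ⟶ Z`, `g : Y ⟶ Z` and a field homomorphism `σ : k →+* L`, if `range (g ⊗_σ L) ⊆ range (f ⊗_σ L)` then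
`range g ⊆ range f` — the projections `(-) ⊗_σ L → (-)` are surjective (base change of the surjective `Spec L → Spec k`,
[StacksProject] Tag 01S1) and natural. [cite: StacksProject, Tag 01S1] -/
theorem range_subset_of_baseChangeHom {X Y Z : SchemeOver k} (f : X ⟶ Z) (g : Y ⟶ Z)
    (h : Set.range ⇑((baseChangeHom σ).map g).left ⊆ Set.range ⇑((baseChangeHom σ).map f).left) :
    Set.range ⇑g.left ⊆ Set.range ⇑f.left := by
  haveI := surjective_specMap_ofHom' σ
  haveI : Surjective (baseChangeHomFst σ Y) :=
    MorphismProperty.pullback_fst _ _ inferInstance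
  rintro _ ⟨y, rfl⟩
  obtain ⟨y', hy'⟩ := (baseChangeHomFst σ Y).surjective y
  obtain ⟨x', hx'⟩ := h ⟨y', rfl⟩
  refine ⟨baseChangeHomFst σ X x', ?_⟩
  have hf : (((baseChangeHom σ).map f).left ≫ baseChangeHomFst σ Z) x' =
      (baseChangeHomFst σ X ≫ f.left) x' := by
    rw [baseChangeHom_map_left_comp_fst]
  have hg : (((baseChangeHom σ).map g).left ≫ baseChangeHomFst σ Z) y' =
      (baseChangeHomFst σ Y ≫ g.left) y' := by
    rw [baseChangeHom_map_left_comp_fst]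
  rw [Scheme.Hom.comp_apply, Scheme.Hom.comp_apply] at hf hg
  rw [← hf, hx', hg, hy']

end BaseChange

/-! ## §3 Towers of closed subschemes: restricted transitions assemble into a functor -/

section Tower

variable {S : Scheme.{u}} {C : Type v} [Category.{w} C]

/-- **Towers of reduced closed subschemes.**  Let `N : C ⥤ Over S` be a diagram of `S`-schemes and, for every `c`,
`j c : Z c ⟶ N c` a closed immersion over `S` with `Z c` reduced, such that each transition carries images into images:
`range (j c ≫ N.map f) ⊆ range (j c')` for `f : c ⟶ c'`.  Then there are a functor `M : C ⥤ Over S`, a natural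
transformation `ι : M ⟶ N` and isomorphisms `e c : M c ≅ Z c` with `(e c).hom ≫ j c = ι.app c` (so every `ι.app c` is a
closed immersion and `M.map f` is THE restriction of `N.map f`) — the transitions `Z c ⟶ Z c'` exist and are unique by
`existsUnique_overHom_comp_eq_of_range_subset`, and functoriality follows from uniqueness.  The projective-system
bookkeeping of [Deligne1971TravauxShimura] Variante 5.9 (descended levels of a canonical model form a projective system).
[cite: Deligne1971TravauxShimura, Variante 5.9 p. 157] [cite: GortzWedhorn2020, Prop. 4.32] -/
theorem exists_functor_of_forall_range_subset (N : C ⥤ Over S) (Z : C → Over S)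
    (j : ∀ c, Z c ⟶ N.obj c) [∀ c, IsClosedImmersion (j c).left] [∀ c, IsReduced (Z c).left]
    (h : ∀ ⦃c c' : C⦄ (f : c ⟶ c'), Set.range ⇑(j c ≫ N.map f).left ⊆ Set.range ⇑(j c').left) :
    ∃ (M : C ⥤ Over S) (ι : M ⟶ N) (e : ∀ c, M.obj c ≅ Z c),
      (∀ c, IsClosedImmersion (ι.app c).left) ∧ ∀ c, (e c).hom ≫ j c = ι.app c := by
  -- the unique restricted transition
  have hex : ∀ ⦃c c' : C⦄ (f : c ⟶ c'), ∃! m : Z c ⟶ Z c', m ≫ j c' = j c ≫ N.map f :=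
    fun c c' f => existsUnique_overHom_comp_eq_of_range_subset (j c') (j c ≫ N.map f) (h f)
  choose m hm using fun c c' (f : c ⟶ c') => (hex f).exists
  have huniq' : ∀ ⦃c c' : C⦄ (f : c ⟶ c') (m' : Z c ⟶ Z c'), m' ≫ j c' = j c ≫ N.map f → m' = m c c' f :=
    fun c c' f m' hm' => (hex f).unique hm' (hm c c' f)
  let M : C ⥤ Over S :=
    { obj := Z
      map := fun {c c'} f => m c c' f
      map_id := fun c => by
        have h1 : (𝟙 (Z c)) ≫ j c = j c ≫ N.map (𝟙 c) := by
          rw [Category.id_comp, N.map_id, Category.comp_id]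
        exact (huniq' (𝟙 c) (𝟙 (Z c)) h1).symm
      map_comp := fun {c c' c''} f g => by
        have h2 : (m c c' f ≫ m c' c'' g) ≫ j c'' = j c ≫ N.map (f ≫ g) := by
          rw [Category.assoc, hm c' c'' g, ← Category.assoc, hm c c' f, Category.assoc, N.map_comp]
        exact (huniq' (f ≫ g) _ h2).symm }
  let ι : M ⟶ N :=
    { app := fun c => j c
      naturality := fun c c' f => hm c c' f }
  exact ⟨M, ι, fun c => Iso.refl _, fun c => inferInstanceAs (IsClosedImmersion (j c).left),
    fun c => Category.id_comp _⟩

end Tower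

/-! ## §4 Galois-stable reduced closed SUB-TOWERS of a complexified `K`-tower descend to closed `K`-sub-towers -/

section Galois

open Cardinal
open AbelianVariety (bcFunctor)
open GaloisDescent (gal)

variable {K : Type} [Field K] [Algebra K ℂ] {C : Type v} [Category.{w} C]

/-- **Effective descent of a Galois-stable sub-tower** ([Deligne1971TravauxShimura] Cor. 5.7 + Variante 5.9, the form used
for canonical models of sub-Shimura varieties; [Margulis1991] I (0.11)).  Let `K ⊆ ℂ` be countable, `N : C ⥤ SchemeOver K` a
diagram of `K`-schemes, `Y : C ⥤ SchemeOver ℂ` a diagram of REDUCED `ℂ`-schemes and `κ c : Y c ⟶ (N c) ⊗_K ℂ` closed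
immersions, natural in `c` (`Y.map f ≫ κ c' = κ c ≫ (N.map f) ⊗_K ℂ`), with `Aut(ℂ/K)`-STABLE images.  Then there are a
`K`-diagram `M : C ⥤ SchemeOver K`, a natural transformation `ι : M ⟶ N` of closed immersions and an isomorphism
`e : M ⋙ (− ⊗_K ℂ) ≅ Y` with `e_c ≫ κ c = (ι c) ⊗_K ℂ` — levelwise the tree's
`GaloisDescent.exists_iso_bcFunctor_map_eq_of_isReduced_of_image_subset_complex`; the transitions descend WITHOUT a further
Galois argument (`range_subset_of_baseChangeHom` + `exists_functor_of_forall_range_subset`).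
[cite: Deligne1971TravauxShimura, Cor. 5.7 p. 156 and Variante 5.9 p. 157] [cite: Margulis1991, Ch. I (0.11) p. 17] -/
theorem exists_subtower_of_stable (hK : #K ≤ ℵ₀) (N : C ⥤ SchemeOver K) (Y : C ⥤ SchemeOver ℂ)
    (κ : ∀ c, Y.obj c ⟶ (bcFunctor K ℂ).obj (N.obj c)) [∀ c, IsClosedImmersion (κ c).left]
    [∀ c, IsReduced (Y.obj c).left]
    (hκ : ∀ ⦃c c' : C⦄ (f : c ⟶ c'), Y.map f ≫ κ c' = κ c ≫ (bcFunctor K ℂ).map (N.map f))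
    (hst : ∀ c (σ : ℂ ≃ₐ[K] ℂ),
      ⇑(gal ℂ (N.obj c) σ) '' Set.range ⇑(κ c).left ⊆ Set.range ⇑(κ c).left) :
    ∃ (M : C ⥤ SchemeOver K) (ι : M ⟶ N) (e : M ⋙ bcFunctor K ℂ ≅ Y),
      (∀ c, IsClosedImmersion (ι.app c).left) ∧ ∀ c, e.hom.app c ≫ κ c = (bcFunctor K ℂ).map (ι.app c) := by
  -- levelwise descent
  have hlev : ∀ c, ∃ (Z : SchemeOver K) (j : Z ⟶ N.obj c) (_ : IsClosedImmersion j.left)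
      (e : Y.obj c ≅ (bcFunctor K ℂ).obj Z), e.hom ≫ (bcFunctor K ℂ).map j = κ c :=
    fun c => GaloisDescent.exists_iso_bcFunctor_map_eq_of_isReduced_of_image_subset_complex
      (N.obj c) hK (κ c) (hst c)
  choose Z j hj e he using hlev
  haveI : ∀ c, IsClosedImmersion (j c).left := hj
  -- the descended levels are reduced
  haveI hZred : ∀ c, IsReduced (Z c).left := by
    intro c
    haveI : IsIso (e c).inv.left :=
      inferInstanceAs (IsIso ((Over.forget _).map (e c).inv))
    haveI : IsReduced ((bcFunctor K ℂ).obj (Z c)).left :=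
      isReduced_of_isOpenImmersion (e c).inv.left
    haveI : IsReduced ((baseChangeHom (algebraMap K ℂ)).obj (Z c)).left :=
      inferInstanceAs (IsReduced ((bcFunctor K ℂ).obj (Z c)).left)
    exact isReduced_of_baseChangeHom (algebraMap K ℂ) (Z c)
  -- `(j c)_ℂ = (e c)⁻¹ ≫ κ_c`
  have h1 : ∀ c, (e c).inv ≫ κ c = (bcFunctor K ℂ).map (j c) :=
    fun c => ((Iso.eq_inv_comp (e c)).mpr (he c)).symm
  -- the complexified transitions factor through `(j c')_ℂ`
  have hbc : ∀ ⦃c c' : C⦄ (f : c ⟶ c'),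
      (bcFunctor K ℂ).map (j c ≫ N.map f) =
        ((e c).inv ≫ Y.map f ≫ (e c').hom) ≫ (bcFunctor K ℂ).map (j c') := by
    intro c c' f
    rw [Functor.map_comp, ← h1 c, Category.assoc, ← hκ f, ← he c']
    simp only [Category.assoc]
  -- hence the transitions map images into images (checked over `ℂ`)
  have hrange : ∀ ⦃c c' : C⦄ (f : c ⟶ c'),
      Set.range ⇑(j c ≫ N.map f).left ⊆ Set.range ⇑(j c').left := by
    intro c c' f
    refine range_subset_of_baseChangeHom (algebraMap K ℂ) (j c') (j c ≫ N.map f) ?_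
    change Set.range ⇑((bcFunctor K ℂ).map (j c ≫ N.map f)).left ⊆
      Set.range ⇑((bcFunctor K ℂ).map (j c')).left
    rw [hbc f, Over.comp_left]
    rintro _ ⟨x, rfl⟩
    exact ⟨_, (Scheme.Hom.comp_apply _ _ x).symm⟩
  -- assemble the `K`-tower
  obtain ⟨M, ι, e', hcl, he'⟩ := exists_functor_of_forall_range_subset N Z j hrange
  -- `(e' c)_ℂ ≫ (e c)⁻¹ ≫ κ_c = (ι c)_ℂ`
  have h3 : ∀ c, (bcFunctor K ℂ).map (e' c).hom ≫ (e c).inv ≫ κ c = (bcFunctor K ℂ).map (ι.app c) := by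
    intro c
    have h := congrArg (fun φ => (bcFunctor K ℂ).map φ) (he' c)
    simp only [Functor.map_comp] at h
    rw [h1 c]
    exact h
  haveI hmono : ∀ c, Mono (κ c) := fun c =>
    (Over.forget _).mono_of_mono_map (inferInstanceAs (Mono (κ c).left))
  -- the comparison `M ⊗ ℂ ≅ Y`
  have hnat : ∀ ⦃c c' : C⦄ (f : c ⟶ c'),
      (bcFunctor K ℂ).map (M.map f) ≫ ((bcFunctor K ℂ).map (e' c').hom ≫ (e c').inv) =
        ((bcFunctor K ℂ).map (e' c).hom ≫ (e c).inv) ≫ Y.map f := by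
    intro c c' f
    rw [← cancel_mono (κ c')]
    simp only [Category.assoc]
    rw [h3 c', ← Functor.map_comp, ι.naturality f, hκ f, reassoc_of% (h1 c), ← Functor.map_comp,
      ← Functor.map_comp, ← Category.assoc (e' c).hom, he' c]
  let E : M ⋙ bcFunctor K ℂ ≅ Y :=
    NatIso.ofComponents (fun c => (bcFunctor K ℂ).mapIso (e' c) ≪≫ (e c).symm) (fun f => hnat f)
  refine ⟨M, ι, E, hcl, fun c => ?_⟩
  change ((bcFunctor K ℂ).map (e' c).hom ≫ (e c).inv) ≫ κ c = (bcFunctor K ℂ).map (ι.app c)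
  rw [Category.assoc, h3 c]

end Galois

end Literature.AlgebraicGeometry.Motives

end
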